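import Mathlib.Tactic
import Literature.Geometry.Lorentzian.KlainermanSzeftel2021.GCMHRungLedger
import Literature.Geometry.Lorentzian.KlainermanSzeftel2021.ExtensionRegularityLedger

/-!
# Theorems M0 and M6 (initialization): the printed derivative budgets of [KS] §8.3 (Steps 8–24) and §8.4 (Steps 1–9)

CITATION HEADER (lean-in-tree rule 2026-08-18).  Kernel-checked transcription of INTEGER BOOKKEEPING printed in
* [KS] S. Klainerman, J. Szeftel, *Kerr stability for small angular momentum*, Pure Appl. Math. Q. **19** (2023) no. 3, 791–1678
  = bib key `KlainermanSzeftel2023`, read as the authors' accepted version HAL hal-04280491 (`HAL p.N Ln` = PDF page N, text line n;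
  printed page = N − 1), AND as the e-print arXiv:2104.11857v1 = bib key `KlainermanSzeftel2021` (TeX `Main-Kerr-arxiv.tex`, `v1 l.N`);
  the two texts print the SAME integer at every locus quoted below (no `[J]`-delta was found in §8.3 Steps 8–24, §8.4, §9.5).
Display numbers `(8.3.N)`, `(8.4.N)`, `(9.5.N)` are those of [J]; e-print displays are located by TeX line and label.

WHAT IS TRANSCRIBED.  Only the displayed derivative indices `k ≤ k_large + n` of the two initialization theorems:
* §1 Theorem M0 (v1 l.6649–6667; proof §8.3, v1 l.19326–20966 = HAL p.488–532): data `𝓘_{k_large+10}`, the geodesic foliation of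
  Prop 8.2.7 at `k_large + 7`, the GCM sphere `S'_1` at `𝔥_{k_large+1}` ((8.3.21), (8.3.33)), the Ricci coefficients of the spheres `S'` at
  `k_large` ((8.3.34)), the last slice and the three regions down to the conclusion `k ≤ k_large − 2`; together with two displays whose
  printed index is that of the PARALLEL proof of Theorem M0-PT ([J] §9.5 = v1 §9.8: "Steps 1'–24' with k_large replaced by k_large + 7").
* §2 Theorem M6 (v1 l.6774–6776; proof §8.4, v1 l.20967–21592 = HAL p.535–550): `s_max = k_large + 7`, (8.4.3)/(8.4.4), the descent
  through Steps 4–8 to `Σ_*` at `k_large + 2`, (8.4.28) on `(ext)ℳ`, (8.4.31) on `(int)ℳ`/`(top)ℳ`, and the concluding line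
  `𝔑^{(Sup)}_{k_large} + 𝔑^{(Dec)}_{k_small} ≲ ε₀`; this itemises `GCMHRungLedger.descentLoss = 6`.
* §3 the word-for-word parallel concluding passages of Theorem M7 ((8.5.67)/(8.5.68), `ExtensionRegularityLedger.intTopLevel/finalLevel`)
  and of Theorem M8 Step 6 ([J] §9.4, HAL p.620–621 = v1 l.24215–24297), which charge TWO derivatives from the same display shape to the
  combined norm where §8.4 Step 9 charges ONE.

WHAT IS CERTIFIED.  ℕ-arithmetic only: which printed indices follow from which by the displayed losses, where the chains close and with
what slack, and the size of the three recorded excesses/discrepancies.  NOTHING analytic (no estimate, no Sobolev embedding, no transport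
lemma) is formalised or asserted; every `def` is a printed integer with its locus, every `theorem` is `omega`/`decide` arithmetic on them.
In particular §3 does NOT adjudicate which of the two printed accountings is the intended one; it records both and their consequences.

STATUS-RELATION.  Companion to `GCMHRungLedger` (§8.4 Steps 1–2, the rung census; p181526) and `ExtensionRegularityLedger` (§8.5; p181958)
of this directory; uses their constants by name and introduces no new reading of theirs.
-/

namespace Literature.Geometry.Lorentzian.KlainermanSzeftel2021.InitializationLedger

/-! ## §1 Theorem M0: the printed levels of §8.3, as functions of `kl = k_large` -/

/-- Data level `𝓘_{k_large+10} ≤ ε₀` (hypothesis of Thm M0 and of the Main Theorem). Same integer as `GCMHRungLedger.dataIndex`.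
[cite: KlainermanSzeftel2021, Thm M0, l.6649–6652, Main Thm l.6210–6212; KlainermanSzeftel2023, Thm M0, HAL p.157] -/
def dataLevel (kl : ℕ) : ℕ := kl + 10

/-- Prop 8.2.7: Ricci/curvature of the outgoing geodesic foliation of `(ext)L̃₀` at `k ≤ k_large + 7` from data at `k_large + 10`
(loss `GCMHRungLedger.prop827Loss = 3`). [cite: KlainermanSzeftel2021, Prop 8.2.7, l.19262–19278; KlainermanSzeftel2023, Prop 8.2.7, HAL p.486–487] -/
def geodesicRicciLevel (kl : ℕ) : ℕ := kl + 7

/-- The frame coefficients `(f', f̲', λ')` of the geodesic foliation carry one more derivative than its Ricci coefficients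
(`Ĩ𝓚_k := Ĩ𝓚'_k + Ĩ𝓚''_{k+1}`), displayed `𝔡^{≤k_large+8}` in Step 19. [cite: KlainermanSzeftel2021, l.19240, l.20713; KlainermanSzeftel2023, HAL p.526 L8] -/
def geodesicFrameLevel (kl : ℕ) : ℕ := kl + 8

/-- Application of [GCM2] Prop 8.1 (restated as Prop 8.3.8-J) with "`s_max = k_large`". [cite: KlainermanSzeftel2023, HAL p.500 L16; KlainermanSzeftel2021, l.19781, l.20118] -/
def smaxM0 (kl : ℕ) : ℕ := kl

/-- (8.3.21)/(8.3.33): `(f, f̲, λ̌) ∈ 𝔥_{k_large+1}(S'_1)` — [GCM2]'s output order `s_max + 1`.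
[cite: KlainermanSzeftel2023, (8.3.21) HAL p.500 L22, (8.3.33) p.510 L94; KlainermanSzeftel2021, l.19781–19790, l.20139–20143] -/
def gcmSphereLevel (kl : ℕ) : ℕ := kl + 1

/-- Step 10 / Step 13: the Hodge system `(d₂*'f, curl'f)` is consumed at `k ≤ k_large` to give `f` at `k_large + 1` modulo `ℓ = 1`
((8.3.26)), and Step 13 reads (8.3.27) at `k ≤ k_large + 1`. [cite: KlainermanSzeftel2023, (8.3.26) HAL p.504 L11–17, Step 13 p.509 L78–84;
KlainermanSzeftel2021, l.20099–20101] -/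
def step13ConsumedLevel (kl : ℕ) : ℕ := kl + 1

/-- Step 11, DISPLAYED: `curl'(f)` controlled for `k ≤ k_large + 7`. [cite: KlainermanSzeftel2021, l.19917; KlainermanSzeftel2023, HAL p.504 L35–38] -/
def step11CurlDisplayed (kl : ℕ) : ℕ := kl + 7

/-- Step 11, DISPLAYED: (8.3.27) `max_{k ≤ k_large+8} ‖𝔡̸'^k f‖_{L²(S')} ≲ ε₀` (modulo `ℓ = 1`).
[cite: KlainermanSzeftel2021, `eqEstimateStep11-8`, l.19922; KlainermanSzeftel2023, (8.3.27), HAL p.504 L41–45] -/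
def step11FDisplayed (kl : ℕ) : ℕ := kl + 8

/-- The UNPRIMED level at which Step 11's curl estimate is needed: `k_large` (one below the `f`-level it produces). [folklore] -/
def step11CurlNeeded (kl : ℕ) : ℕ := kl

/-- (8.3.34): Ricci coefficients `χ̂', η', trχ̲̌', χ̲̂', ω̲̌', ξ̲'` of the spheres `S'` at `k ≤ k_large` (`ζ'` at `k_large − 1`, `β'` at `k_large`).
[cite: KlainermanSzeftel2023, (8.3.34), HAL p.511 L2–10; KlainermanSzeftel2021, l.20146–20155] -/
def ricciSprimeLevel (kl : ℕ) : ℕ := kl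

/-- Step 18, DISPLAYED: "recall from (8.3.34) … for `k ≤ k_large + 7` for the frame of `Σ_*`", and (8.3.55) at `k_large + 7`.
[cite: KlainermanSzeftel2021, l.20686–20693; KlainermanSzeftel2023, HAL p.525 L55–62] -/
def step18RecallDisplayed (kl : ℕ) : ℕ := kl + 7

/-- Step 18, DISPLAYED: (8.3.56) `(ν(r') + 2, b_* + 1 + 2m/r')` at `k ≤ k_large + 6`. [cite: KlainermanSzeftel2021, l.20696–20699; KlainermanSzeftel2023, (8.3.56), HAL p.525 L65–66] -/
def step18OutDisplayed (kl : ℕ) : ℕ := kl + 6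

/-- Step 18's displayed internal loss: `(k_large + 7) − (k_large + 6) = 1`. [cite: KlainermanSzeftel2023, (8.3.55)–(8.3.56), HAL p.525] -/
def step18Loss : ℕ := 1

/-- Step 18's output level when the recall is taken at (8.3.34)'s OWN printed index `k_large` and the displayed loss 1 is kept. [folklore] -/
def step18OutHonest (kl : ℕ) : ℕ := ricciSprimeLevel kl - step18Loss

/-- Step 19: (8.3.57) `sup r|𝔡^{≤k_large} f'''| + sup |𝔡^{≤k_large}(f̲''', log λ''')|`; of these only `f̲''' = −(ν(r') − b_*)(1 − ¼ b_*|f''|²)⁻¹ f''`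
depends on Step 18's `(ν(r'), b_*)`. [cite: KlainermanSzeftel2023, (8.3.57), HAL p.526 L45–48; KlainermanSzeftel2021, l.20719–20741] -/
def step19FbLevel (kl : ℕ) : ℕ := kl

/-- Steps 20–22, `(ext)ℳ`: (8.3.66) `r|𝔡^{≤k_large} f| + |𝔡^{≤k_large} log λ|` … [cite: KlainermanSzeftel2023, (8.3.58) HAL p.527, (8.3.66) p.531 L41–43;
KlainermanSzeftel2021, l.20765, l.20894] -/
def extFLaLevel (kl : ℕ) : ℕ := kl

/-- Step 22, `(ext)ℳ`: `f̲` at `k ≤ k_large − 1` in (8.3.66) (its transport equation loses one derivative relative to `(f, λ)`).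
[cite: KlainermanSzeftel2023, (8.3.66), HAL p.531 L41–43; KlainermanSzeftel2021, l.20886–20894] -/
def extFbLevel (kl : ℕ) : ℕ := kl - 1

/-- Step 23, `(int)ℳ`: (8.3.68) `(f̲', log λ')` at `k ≤ k_large − 1`. [cite: KlainermanSzeftel2023, (8.3.68), HAL p.532 L30–32; KlainermanSzeftel2021, l.20928] -/
def intFbLaLevel (kl : ℕ) : ℕ := kl - 1

/-- Step 23, `(int)ℳ`: (8.3.68) `(r' − r, f')` at `k ≤ k_large − 2`. [cite: KlainermanSzeftel2023, (8.3.68), HAL p.532 L30–32; KlainermanSzeftel2021, l.20928] -/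
def intRFLevel (kl : ℕ) : ℕ := kl - 2

/-- Step 24: the conclusion of Thm M0 concerns curvature components (and `m, a`) only, and curvature transforms ALGEBRAICALLY under a
frame change (no derivative of `(f, f̲, λ)`): conversion cost 0. [cite: KlainermanSzeftel2023, Step 24, HAL p.532 L40–43; KlainermanSzeftel2021, l.20936–20944] -/
def curvatureCost : ℕ := 0

/-- Target of Thm M0: `k ≤ k_large − 2`. [cite: KlainermanSzeftel2021, Thm M0, l.6649–6667, l.24328; KlainermanSzeftel2023, Thm M0 HAL p.157, Rem 9.5.1 p.635 L33] -/
def targetM0 (kl : ℕ) : ℕ := kl - 2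

/-- [J] §9.5 (= v1 §9.8): the proof of Thm M0-PT is Steps 1'–24' of §8.3 "with `k_large` being replaced by `k_large + 7`"
((9.5.3)/(9.5.4) at `k_large + 7`, (9.5.5) = analog of (8.3.33) at `k_large + 8`). [cite: KlainermanSzeftel2023, §9.5, HAL p.636 L25–46, Rem 9.5.2;
KlainermanSzeftel2021, l.24787–24808] -/
def primedShift : ℕ := 7

/-- Unfolding lemma. [folklore] -/
@[simp] lemma dataLevel_def (kl : ℕ) : dataLevel kl = kl + 10 := rfl
/-- Unfolding lemma. [folklore] -/
@[simp] lemma geodesicRicciLevel_def (kl : ℕ) : geodesicRicciLevel kl = kl + 7 := rfl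
/-- Unfolding lemma. [folklore] -/
@[simp] lemma geodesicFrameLevel_def (kl : ℕ) : geodesicFrameLevel kl = kl + 8 := rfl
/-- Unfolding lemma. [folklore] -/
@[simp] lemma smaxM0_def (kl : ℕ) : smaxM0 kl = kl := rfl
/-- Unfolding lemma. [folklore] -/
@[simp] lemma gcmSphereLevel_def (kl : ℕ) : gcmSphereLevel kl = kl + 1 := rfl
/-- Unfolding lemma. [folklore] -/
@[simp] lemma step13ConsumedLevel_def (kl : ℕ) : step13ConsumedLevel kl = kl + 1 := rfl
/-- Unfolding lemma. [folklore] -/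
@[simp] lemma step11CurlDisplayed_def (kl : ℕ) : step11CurlDisplayed kl = kl + 7 := rfl
/-- Unfolding lemma. [folklore] -/
@[simp] lemma step11FDisplayed_def (kl : ℕ) : step11FDisplayed kl = kl + 8 := rfl
/-- Unfolding lemma. [folklore] -/
@[simp] lemma step11CurlNeeded_def (kl : ℕ) : step11CurlNeeded kl = kl := rfl
/-- Unfolding lemma. [folklore] -/
@[simp] lemma ricciSprimeLevel_def (kl : ℕ) : ricciSprimeLevel kl = kl := rfl
/-- Unfolding lemma. [folklore] -/
@[simp] lemma step18RecallDisplayed_def (kl : ℕ) : step18RecallDisplayed kl = kl + 7 := rfl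
/-- Unfolding lemma. [folklore] -/
@[simp] lemma step18OutDisplayed_def (kl : ℕ) : step18OutDisplayed kl = kl + 6 := rfl
/-- Unfolding lemma. [folklore] -/
@[simp] lemma step18Loss_def : step18Loss = 1 := rfl
/-- Unfolding lemma. [folklore] -/
@[simp] lemma step18OutHonest_def (kl : ℕ) : step18OutHonest kl = ricciSprimeLevel kl - step18Loss := rfl
/-- Unfolding lemma. [folklore] -/
@[simp] lemma step19FbLevel_def (kl : ℕ) : step19FbLevel kl = kl := rfl
/-- Unfolding lemma. [folklore] -/
@[simp] lemma extFLaLevel_def (kl : ℕ) : extFLaLevel kl = kl := rfl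
/-- Unfolding lemma. [folklore] -/
@[simp] lemma extFbLevel_def (kl : ℕ) : extFbLevel kl = kl - 1 := rfl
/-- Unfolding lemma. [folklore] -/
@[simp] lemma intFbLaLevel_def (kl : ℕ) : intFbLaLevel kl = kl - 1 := rfl
/-- Unfolding lemma. [folklore] -/
@[simp] lemma intRFLevel_def (kl : ℕ) : intRFLevel kl = kl - 2 := rfl
/-- Unfolding lemma. [folklore] -/
@[simp] lemma curvatureCost_def : curvatureCost = 0 := rfl
/-- Unfolding lemma. [folklore] -/
@[simp] lemma targetM0_def (kl : ℕ) : targetM0 kl = kl - 2 := rfl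
/-- Unfolding lemma. [folklore] -/
@[simp] lemma primedShift_def : primedShift = 7 := rfl

/-! ### §1.1 The chain of Theorem M0 closes, with zero slack on `(int)ℳ` -/

/-- The unexceptional links: data minus Prop 8.2.7's loss is the geodesic level (= `GCMHRungLedger.smaxKS`, the index also used by §8.4);
the frame coefficients sit one above; [GCM2]'s output is `s_max + 1`; `(ext)ℳ`: `f̲` one below `(f, λ)`; `(int)ℳ`: `(r'−r, f')` one below `(f̲', λ')`.
[cite: KlainermanSzeftel2023, HAL p.486–487, p.500, p.526, p.531–532] -/
theorem m0_chain_steps (kl : ℕ) :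
    dataLevel kl - GCMHRungLedger.prop827Loss = geodesicRicciLevel kl ∧ geodesicRicciLevel kl = GCMHRungLedger.smaxKS kl ∧
    geodesicFrameLevel kl = geodesicRicciLevel kl + 1 ∧ gcmSphereLevel kl = smaxM0 kl + 1 ∧
    extFbLevel kl = extFLaLevel kl - 1 ∧ intRFLevel kl = intFbLaLevel kl - 1 := by
  dsimp only [dataLevel_def, GCMHRungLedger.prop827Loss_def, geodesicRicciLevel_def, GCMHRungLedger.smaxKS_def, geodesicFrameLevel_def,
    gcmSphereLevel_def, smaxM0_def, extFbLevel_def, extFLaLevel_def, intRFLevel_def, intFbLaLevel_def]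
  omega

/-- **Theorem M0's printed budget closes**: curvature costs no derivative of the frame coefficients, so `(int)ℳ` delivers exactly the
target `k_large − 2` (slack 0, binding branch = `f'` of Step 23) and `(ext)ℳ` delivers `k_large − 1` (slack 1).
[cite: KlainermanSzeftel2023, (8.3.66), (8.3.68), Step 24, HAL p.531–532] -/
theorem m0_closes (kl : ℕ) (hkl : 2 ≤ kl) :
    intRFLevel kl - curvatureCost = targetM0 kl ∧ extFbLevel kl - curvatureCost = targetM0 kl + 1 ∧
    targetM0 kl ≤ min (intRFLevel kl) (extFbLevel kl) - curvatureCost := by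
  dsimp only [intRFLevel_def, curvatureCost_def, targetM0_def, extFbLevel_def]; omega

/-! ### §1.2 Datum (i): Step 11 prints the primed (Theorem M0-PT) indices -/

/-- **Step 11's two displays exceed what Step 13 consumes by exactly `primedShift = 7`**, i.e. they are the levels of the parallel
Step 11' of [J] §9.5 (`k_large ↦ k_large + 7`): (8.3.27) displays `k_large + 8` where Step 13 reads `k_large + 1`, and the curl
estimate displays `k_large + 7` where `k_large` is used. [cite: KlainermanSzeftel2023, HAL p.504 L35–45 vs p.509 L78–84, §9.5 p.636 L43–46;
KlainermanSzeftel2021, l.19917–19922 vs l.20099–20101, l.24798–24802] -/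
theorem step11_prints_primed (kl : ℕ) :
    step11FDisplayed kl = step13ConsumedLevel (kl + primedShift) ∧ step11CurlDisplayed kl = step11CurlNeeded (kl + primedShift) ∧
    step11FDisplayed kl - step13ConsumedLevel kl = primedShift ∧ step11CurlDisplayed kl - step11CurlNeeded kl = primedShift := by
  dsimp only [step11FDisplayed_def, step13ConsumedLevel_def, primedShift_def, step11CurlDisplayed_def, step11CurlNeeded_def]; omega

/-- **Datum (i) carries no load**: the consumer's level `k_large + 1` is at most the displayed one, and it equals [GCM2]'s output level
(8.3.21)/(8.3.33), which is what the rest of §8.3 uses. [cite: KlainermanSzeftel2023, (8.3.33), HAL p.510 L94] -/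
theorem step11_excess_unused (kl : ℕ) :
    step13ConsumedLevel kl ≤ step11FDisplayed kl ∧ step13ConsumedLevel kl = gcmSphereLevel kl := by
  dsimp only [step13ConsumedLevel_def, step11FDisplayed_def, gcmSphereLevel_def]; omega

/-! ### §1.3 Datum (ii): Step 18 recalls (8.3.34) at the primed index -/

/-- **Step 18's recall of (8.3.34) exceeds (8.3.34)'s printed index by exactly `primedShift = 7`**, and its output (8.3.56) is the
honest output shifted by 7: again the levels of the primed proof ([J] Rem 9.5.3: under BA-PT the frame of `Σ_*` is controlled for
`k ≤ k_large + 7`, and "there is no need for an analog of Step 18"). [cite: KlainermanSzeftel2023, HAL p.525 L55–66 vs (8.3.34) p.511 L2–10,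
Rem 9.5.3 p.639 L60–63; KlainermanSzeftel2021, l.20686–20699 vs l.20146–20155, l.24823, l.24896–24898] -/
theorem step18_prints_primed (kl : ℕ) :
    step18RecallDisplayed kl - ricciSprimeLevel kl = primedShift ∧ step18OutDisplayed kl = step18RecallDisplayed kl - step18Loss ∧
    step18OutDisplayed kl = step18OutHonest (kl + primedShift) := by
  dsimp only [step18RecallDisplayed_def, ricciSprimeLevel_def, primedShift_def, step18OutDisplayed_def, step18Loss_def,
    step18OutHonest_def]; omega

/-- **Datum (ii) carries no load on the honest reading**: with the recall at `k_large` and the displayed loss 1, `(ν(r'), b_*)` — hence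
`f̲'''` — come at `k_large − 1`, which is EXACTLY the order at which `f̲` is carried on `(ext)ℳ` ((8.3.66)) and `(f̲', λ')` on `(int)ℳ` ((8.3.68));
zero slack, nothing downstream reads `f̲'''` above `k_large − 1`. The displayed `k_large` for `f̲'''` in (8.3.57) exceeds that supply by one.
[cite: KlainermanSzeftel2023, (8.3.57) HAL p.526 L45–48, (8.3.66) p.531, (8.3.68) p.532] -/
theorem step18_honest_meets_consumers (kl : ℕ) (hkl : 1 ≤ kl) :
    step18OutHonest kl = extFbLevel kl ∧ step18OutHonest kl = intFbLaLevel kl ∧ step19FbLevel kl = step18OutHonest kl + 1 := by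
  dsimp only [step18OutHonest_def, ricciSprimeLevel_def, step18Loss_def, extFbLevel_def, intFbLaLevel_def, step19FbLevel_def]; omega

/-! ## §2 Theorem M6: the printed levels of §8.4 and the itemised descent `k_large + 6 → k_large` -/

/-- Step 1: "`s_max := k_large + 7`" (= `GCMHRungLedger.smaxKS`). [cite: KlainermanSzeftel2023, HAL p.535 L50–52; KlainermanSzeftel2021, l.21001] -/
def smaxM6 (kl : ℕ) : ℕ := GCMHRungLedger.smaxKS kl

/-- Step 2: (8.4.3) `L²(S)` control for `k ≤ k_large + 8` (= Shen's `K = s_max + 1`). [cite: KlainermanSzeftel2023, (8.4.3), HAL p.536; KlainermanSzeftel2021, l.21083] -/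
def l2Level (kl : ℕ) : ℕ := GCMHRungLedger.K (GCMHRungLedger.smaxKS kl)

/-- Step 2: (8.4.4) sup control for `k ≤ k_large + 6` (= `GCMHRungLedger.ksTopIndex`, Sobolev cost 2). [cite: KlainermanSzeftel2023, (8.4.4) fn 29, HAL p.536; KlainermanSzeftel2021, l.21087] -/
def supLevel (kl : ℕ) : ℕ := GCMHRungLedger.ksTopIndex kl

/-- Step 4: `k ≤ k_large + 6`. [cite: KlainermanSzeftel2021, l.21159–21177; KlainermanSzeftel2023, HAL p.539 L2, L69] -/
def step4Level (kl : ℕ) : ℕ := kl + 6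

/-- Step 5: `κ` of the frame of `Σ_*` at `k ≤ k_large + 5`. [cite: KlainermanSzeftel2021, l.21205–21209; KlainermanSzeftel2023, HAL p.540 L21–28] -/
def step5KappaLevel (kl : ℕ) : ℕ := kl + 5

/-- Step 5, next display: `k ≤ k_large + 4`. [cite: KlainermanSzeftel2021, l.21223–21239; KlainermanSzeftel2023, HAL p.540–541] -/
def step5bLevel (kl : ℕ) : ℕ := kl + 4

/-- Step 5, next display: `k ≤ k_large + 3`. [cite: KlainermanSzeftel2021, l.21247; KlainermanSzeftel2023, HAL p.541 L20] -/
def step5cLevel (kl : ℕ) : ℕ := kl + 3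

/-- Steps 5–8: everything on `Σ_*` — `(ζ, η)`, (8.4.26), and (8.4.27) `(f, f̲, λ − 1, r' − r, a J'^{(0)} − a₀J^{(0)}, …)` including the
`e_4'` derivatives — at `k ≤ k_large + 2`. [cite: KlainermanSzeftel2023, HAL p.542 L62, (8.4.26) p.548 L10–23, (8.4.27) p.548 L52–78;
KlainermanSzeftel2021, l.21251, l.21301, l.21490, `eq:controlffblafinalonSigma*widetildeforThmM7:ThmM6bis` l.21510–21515] -/
def sigmaStarLevel (kl : ℕ) : ℕ := kl + 2

/-- Steps 6–7: the `J`-modes on the spheres of `Σ_*` in `𝔥_{k_large+7}(S)` (no loss there). [cite: KlainermanSzeftel2023, HAL p.543 L88, p.544 L18,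
p.546 L16, p.548 L3; KlainermanSzeftel2021, l.21338, l.21358, l.21426, l.21444–21485] -/
def jModesLevel (kl : ℕ) : ℕ := kl + 7

/-- Step 8, `(ext)ℳ`: (8.4.28) `sup r(|𝔡^k(f, log λ)| + |𝔡^{k−1} f̲|) ≲ ε₀` for `k ≤ k_large + 2` — the display index.
[cite: KlainermanSzeftel2023, (8.4.28), HAL p.549 L24–33; KlainermanSzeftel2021, `eq:controlffblaonMextwidetildeThmM7ThmM6`, l.21531–21533] -/
def extLevel (kl : ℕ) : ℕ := kl + 2

/-- Step 8, `(ext)ℳ`: the lossy coefficient `f̲` at `k − 1 ≤ k_large + 1` in (8.4.28) (its transport equation has the source `𝒟'(log λ)`).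
[cite: KlainermanSzeftel2023, (8.4.28) and the transport equations above it, HAL p.549 L1–33] -/
def extFbLevel6 (kl : ℕ) : ℕ := kl + 1

/-- Step 9, `(int)ℳ` (and "similar for `(top)ℳ`"): (8.4.31) `|𝔡^k(f̲, log λ)| + |𝔡^{k−1} f| + |𝔡^k(r' − r)| + …` for `k ≤ k_large + 1` —
the display index. [cite: KlainermanSzeftel2023, (8.4.31), HAL p.550 L32–44; KlainermanSzeftel2021, `eq:controlffblaonMintwidetildeThmM7ThmM6`, l.21571–21577] -/
def intLevel (kl : ℕ) : ℕ := kl + 1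

/-- Step 9, `(int)ℳ`/`(top)ℳ`: the lossy coefficient `f` at `k − 1 ≤ k_large` in (8.4.31). [cite: KlainermanSzeftel2023, (8.4.31), HAL p.550 L36–43] -/
def intFLevel6 (kl : ℕ) : ℕ := kl

/-- The concluding line of §8.4: "`𝔑^{(Sup)}_{k_large} + 𝔑^{(Dec)}_{k_small} ≲ ε₀` … using the transformation formulas of
Proposition 2.2.3". [cite: KlainermanSzeftel2023, HAL p.550 L47–52; KlainermanSzeftel2021, l.21584–21590] -/
def finalM6 (kl : ℕ) : ℕ := kl

/-- The index Theorem M6 must reach: `𝒰(u_*)` is defined by `𝔑^{(Sup)}_{k_large} ≤ ε`, `𝔑^{(Dec)}_{k_small} ≤ ε` (bootstrap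
assumptions BA-B/BA-D), and Thm M6 asserts `[1, 1 + δ₀] ⊂ 𝒰`. [cite: KlainermanSzeftel2021, Def of `𝒰(u_*)` l.6746–6763, Thm M6 l.6774–6776;
KlainermanSzeftel2023, Def 3.7.1–3.7.2, HAL p.158–159, Thm M6 p.159 L9] -/
def targetM6 (kl : ℕ) : ℕ := kl

/-- §8.4 Step 9's PRINTED charge from the `(int)`/`(top)` display index `k_large + 1` to the combined norm's index `k_large`: one.
[cite: KlainermanSzeftel2023, HAL p.550 L36–52] -/
def lastStepCostM6 : ℕ := 1

/-- Unfolding lemma. [folklore] -/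
@[simp] lemma smaxM6_def (kl : ℕ) : smaxM6 kl = GCMHRungLedger.smaxKS kl := rfl
/-- Unfolding lemma. [folklore] -/
@[simp] lemma l2Level_def (kl : ℕ) : l2Level kl = GCMHRungLedger.K (GCMHRungLedger.smaxKS kl) := rfl
/-- Unfolding lemma. [folklore] -/
@[simp] lemma supLevel_def (kl : ℕ) : supLevel kl = GCMHRungLedger.ksTopIndex kl := rfl
/-- Unfolding lemma. [folklore] -/
@[simp] lemma step4Level_def (kl : ℕ) : step4Level kl = kl + 6 := rfl
/-- Unfolding lemma. [folklore] -/
@[simp] lemma step5KappaLevel_def (kl : ℕ) : step5KappaLevel kl = kl + 5 := rfl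
/-- Unfolding lemma. [folklore] -/
@[simp] lemma step5bLevel_def (kl : ℕ) : step5bLevel kl = kl + 4 := rfl
/-- Unfolding lemma. [folklore] -/
@[simp] lemma step5cLevel_def (kl : ℕ) : step5cLevel kl = kl + 3 := rfl
/-- Unfolding lemma. [folklore] -/
@[simp] lemma sigmaStarLevel_def (kl : ℕ) : sigmaStarLevel kl = kl + 2 := rfl
/-- Unfolding lemma. [folklore] -/
@[simp] lemma jModesLevel_def (kl : ℕ) : jModesLevel kl = kl + 7 := rfl
/-- Unfolding lemma. [folklore] -/
@[simp] lemma extLevel_def (kl : ℕ) : extLevel kl = kl + 2 := rfl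
/-- Unfolding lemma. [folklore] -/
@[simp] lemma extFbLevel6_def (kl : ℕ) : extFbLevel6 kl = kl + 1 := rfl
/-- Unfolding lemma. [folklore] -/
@[simp] lemma intLevel_def (kl : ℕ) : intLevel kl = kl + 1 := rfl
/-- Unfolding lemma. [folklore] -/
@[simp] lemma intFLevel6_def (kl : ℕ) : intFLevel6 kl = kl := rfl
/-- Unfolding lemma. [folklore] -/
@[simp] lemma finalM6_def (kl : ℕ) : finalM6 kl = kl := rfl
/-- Unfolding lemma. [folklore] -/
@[simp] lemma targetM6_def (kl : ℕ) : targetM6 kl = kl := rfl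
/-- Unfolding lemma. [folklore] -/
@[simp] lemma lastStepCostM6_def : lastStepCostM6 = 1 := rfl

/-- The printed levels of §8.4 in closed form. [cite: KlainermanSzeftel2023, §8.4, HAL p.535–550] -/
theorem m6_chain_values (kl : ℕ) :
    smaxM6 kl = kl + 7 ∧ l2Level kl = kl + 8 ∧ supLevel kl = kl + 6 ∧ step4Level kl = kl + 6 ∧ step5KappaLevel kl = kl + 5 ∧
    step5bLevel kl = kl + 4 ∧ step5cLevel kl = kl + 3 ∧ sigmaStarLevel kl = kl + 2 ∧ jModesLevel kl = smaxM6 kl ∧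
    extLevel kl = kl + 2 ∧ extFbLevel6 kl = kl + 1 ∧ intLevel kl = kl + 1 ∧ intFLevel6 kl = kl ∧ finalM6 kl = kl := by
  dsimp only [smaxM6_def, GCMHRungLedger.smaxKS_def, l2Level_def, GCMHRungLedger.K_def, supLevel_def, GCMHRungLedger.ksTopIndex_def,
    step4Level_def, step5KappaLevel_def, step5bLevel_def, step5cLevel_def, sigmaStarLevel_def, jModesLevel_def, extLevel_def,
    extFbLevel6_def, intLevel_def, intFLevel6_def, finalM6_def]
  omega

/-- **`GCMHRungLedger.descentLoss = 6` itemised by the displays**: `4` on `Σ_*` (Steps 4–8: `k_large+6 → k_large+2`), `0` from `Σ_*` to the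
`(ext)ℳ` display index, `1` from the `(ext)ℳ` to the `(int)ℳ` display index (the lossy `f̲` of (8.4.28) initialises (8.4.31)), and the printed
last charge `1`; the chain lands exactly on the target (slack 0). [cite: KlainermanSzeftel2023, §8.4, HAL p.536–550] -/
theorem m6_descent_itemised (kl : ℕ) :
    supLevel kl - sigmaStarLevel kl = 4 ∧ sigmaStarLevel kl = extLevel kl ∧ extLevel kl - intLevel kl = 1 ∧ intLevel kl = extFbLevel6 kl ∧
    intLevel kl - lastStepCostM6 = finalM6 kl ∧ 4 + 0 + 1 + lastStepCostM6 = GCMHRungLedger.descentLoss ∧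
    supLevel kl - GCMHRungLedger.descentLoss = finalM6 kl ∧ finalM6 kl = targetM6 kl ∧ finalM6 kl - targetM6 kl = 0 := by
  dsimp only [supLevel_def, GCMHRungLedger.ksTopIndex_def, sigmaStarLevel_def, extLevel_def, intLevel_def, extFbLevel6_def,
    lastStepCostM6_def, finalM6_def, GCMHRungLedger.descentLoss_def, targetM6_def]
  omega

/-! ## §3 Datum (iii): the last charge — one in §8.4 Step 9, two in the parallel passages of Theorems M7 and M8

The e-print labels of (8.4.27)–(8.4.31) are the §8.5 (Theorem M7) labels with the suffix `ThmM6`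
(`eq:controlffblaonMintwidetildeThmM7ThmM6`, …): the two passages are textually parallel, display by display. -/

/-- Theorem M8, Step 5/6 ([J] §9.4): on `(top)ℳ` and `(int)ℳ` the frame coefficients are displayed as `(f̲', log λ')` resp. `(f̲'', log λ'')`
at `k ≤ k_large + 4` with the lossy `f'`, `f''` at `k_large + 3` — display index `k_large + 4`.
[cite: KlainermanSzeftel2023, HAL p.620 L18–48; KlainermanSzeftel2021, l.24215–24234] -/
def m8IntDisplayLevel (kl : ℕ) : ℕ := kl + 4

/-- Theorem M8, Step 6: "the change of frame formulas of Proposition 2.2.3, we infer, for `k ≤ k_large + 2` … `𝔑^{(Sup)}_{k_large+2} ≲ ε₀ +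
sup 𝔡^{≤k_large+3}(r' − r, …)`". [cite: KlainermanSzeftel2023, HAL p.621 L7–8, L70–86; KlainermanSzeftel2021, l.24251–24297] -/
def m8SupNormLevel (kl : ℕ) : ℕ := kl + 2

/-- Unfolding lemma. [folklore] -/
@[simp] lemma m8IntDisplayLevel_def (kl : ℕ) : m8IntDisplayLevel kl = kl + 4 := rfl
/-- Unfolding lemma. [folklore] -/
@[simp] lemma m8SupNormLevel_def (kl : ℕ) : m8SupNormLevel kl = kl + 2 := rfl

/-- **The three printed last charges**: from a display of the shape "`(two coefficients)` at `k`, `(lossy coefficient)` at `k − 1`, `k ≤ K`" on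
`(int)ℳ`/`(top)ℳ` to the combined sup/decay norm, §8.5 Step 18 (Thm M7: `K = k_* − 10 ↦ 𝔑^{(Dec)}_{k_*−12}`) and §9.4 Step 6 (Thm M8:
`K = k_large + 4 ↦ 𝔑^{(Sup)}_{k_large+2}`) charge TWO, §8.4 Step 9 (Thm M6: `K = k_large + 1 ↦ 𝔑^{(Sup)}_{k_large}`) charges ONE.
[cite: KlainermanSzeftel2023, HAL p.592 L33–53, p.620 L40 – p.621 L8, p.550 L36–52] -/
theorem last_charge_printed (kl ks : ℕ) :
    ExtensionRegularityLedger.intTopLevel ks - ExtensionRegularityLedger.finalLevel ks = 2 ∧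
    m8IntDisplayLevel kl - m8SupNormLevel kl = 2 ∧ intLevel kl - finalM6 kl = 1 := by
  dsimp only [ExtensionRegularityLedger.intTopLevel_def, ExtensionRegularityLedger.finalLevel_def, ExtensionRegularityLedger.kStar_def,
    m8IntDisplayLevel_def, m8SupNormLevel_def, intLevel_def, finalM6_def]
  omega

/-- The charge implied by the displays themselves: the Ricci coefficients of the new frame contain FIRST derivatives of all three coefficients
(Prop 2.2.3: `λ⁻²ξ' = ξ + ½λ⁻¹∇'_4 f + …`, `trχ' ∋ div'f`, `trχ̲' ∋ div'f̲`, `ω', ω̲' ∋ ∇'log λ`), and `(int)𝔅_k = sup_{(int)ℳ}(|𝔡^{≤k}Γ_g| + |𝔡^{≤k}Γ_b|)`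
with the ingoing `Γ_g ∋ Ξ, trX̌, X̂, Ȟ̲` (Def 2.7.3); so a coefficient controlled at order `j` yields these members at order `j − 1`: cost 1 per coefficient,
hence 2 from the display index `K` through the lossy coefficient at `K − 1`. [cite: KlainermanSzeftel2023, Prop 2.2.3 (2.2.6) HAL p.63 L8–23, Def 2.7.3 (2.7.11)
p.105 L26–40, (3.3.16) p.136 L8–16, p.138 L5–6] -/
def frameToRicciCost : ℕ := 1

/-- Unfolding lemma. [folklore] -/
@[simp] lemma frameToRicciCost_def : frameToRicciCost = 1 := rfl

/-- **Counting with `frameToRicciCost` reproduces the charge 2 of Theorems M7/M8 and, applied to §8.4's displays, delivers `(ext)𝔅` exactly at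
`k_large` (slack 0: `(f, λ)` at `k_large + 2 ↦ k_large + 1`, `f̲` at `k_large + 1 ↦ k_large`) but the `f`-dependent members of `(int)𝔅`/`(top)𝔅`
at `k_large − 1`, ONE BELOW the index `k_large` of the concluding line.**  This is arithmetic on printed integers; whether the authors close
`(int)𝔅_{k_large}` by an argument not displayed in §8.4 is not decided here. [cite: KlainermanSzeftel2023, (8.4.28), (8.4.31), HAL p.549–550] -/
theorem m6_last_step_under_cost (kl : ℕ) (hkl : 1 ≤ kl) :
    m8IntDisplayLevel kl - 1 - frameToRicciCost = m8SupNormLevel kl ∧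
    min (extLevel kl - frameToRicciCost) (extFbLevel6 kl - frameToRicciCost) = targetM6 kl ∧
    intLevel kl - frameToRicciCost = targetM6 kl ∧ intFLevel6 kl - frameToRicciCost + 1 = targetM6 kl ∧
    min (intLevel kl - frameToRicciCost) (intFLevel6 kl - frameToRicciCost) < targetM6 kl := by
  dsimp only [m8IntDisplayLevel_def, frameToRicciCost_def, m8SupNormLevel_def, extLevel_def, extFbLevel6_def, targetM6_def, intLevel_def,
    intFLevel6_def]
  omega

/-- **The two accountings, exchanged**: charging Thm M7's printed 2 in §8.4 lands on `k_large − 1 < k_large` (Thm M6 has no slack to absorb it: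
`GCMHRungLedger.repair_indices`, `ExtensionRegularityLedger.m7_vs_m6_slack`); charging §8.4's printed 1 in §8.5 would give Thm M7 slack 9
instead of 8. [cite: KlainermanSzeftel2023, HAL p.550 vs p.592] -/
theorem accountings_exchanged (kl ks : ℕ) (hkl : 1 ≤ kl) :
    intLevel kl - 2 = targetM6 kl - 1 ∧ intLevel kl - 2 < targetM6 kl ∧
    ExtensionRegularityLedger.intTopLevel ks - lastStepCostM6 = ExtensionRegularityLedger.targetLevel ks + 9 ∧
    ExtensionRegularityLedger.slack ks = 8 := by
  dsimp only [intLevel_def, targetM6_def, ExtensionRegularityLedger.intTopLevel_def, lastStepCostM6_def,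
    ExtensionRegularityLedger.targetLevel_def, ExtensionRegularityLedger.slack_def, ExtensionRegularityLedger.finalLevel_def,
    ExtensionRegularityLedger.kStar_def]
  omega

/-- **What would close the count by one derivative** (arithmetic of the candidate repairs, none asserted): (a) the lossy `f` on
`(int)ℳ`/`(top)ℳ` at `k_large + 1` instead of `k_large`; equivalently (b) every §8.4 display one higher, i.e. `Σ_*` at `k_large + 3`, which
under the displayed losses means sup control (8.4.4) at `k_large + 7 = K − 1` (the one rung of slack recorded in `GCMHRungLedger.ks_slack_one_rung`)
or data one index higher, `k_large + 11` (the index of `GCMHRungLedger.repair_indices` (β)). [folklore] -/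
theorem one_more_derivative_closes (kl : ℕ) :
    intFLevel6 kl + 1 - frameToRicciCost = targetM6 kl ∧
    (sigmaStarLevel kl + 1) + (supLevel kl - sigmaStarLevel kl) = GCMHRungLedger.ksTopIndex kl + 1 ∧
    GCMHRungLedger.ksTopIndex kl + 1 = GCMHRungLedger.K (GCMHRungLedger.smaxKS kl) - 1 ∧
    GCMHRungLedger.dataIndex kl + 1 = kl + 11 := by
  dsimp only [intFLevel6_def, frameToRicciCost_def, targetM6_def, sigmaStarLevel_def, supLevel_def, GCMHRungLedger.ksTopIndex_def,
    GCMHRungLedger.K_def, GCMHRungLedger.smaxKS_def, GCMHRungLedger.dataIndex_def]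
  omega

/-! ## §4 Numerical instances (`k_large = 20`, `k_small = 10`) -/

/-- [folklore] -/
example : targetM0 20 = 18 ∧ intRFLevel 20 = 18 ∧ extFbLevel 20 = 19 ∧ step11FDisplayed 20 = 28 ∧ step13ConsumedLevel 20 = 21 ∧
    step18RecallDisplayed 20 = 27 ∧ ricciSprimeLevel 20 = 20 ∧ step18OutHonest 20 = 19 := by decide

/-- [folklore] -/
example : supLevel 20 = 26 ∧ sigmaStarLevel 20 = 22 ∧ extLevel 20 = 22 ∧ intLevel 20 = 21 ∧ finalM6 20 = 20 ∧
    intFLevel6 20 - frameToRicciCost = 19 ∧ ExtensionRegularityLedger.intTopLevel 10 = 20 ∧ ExtensionRegularityLedger.finalLevel 10 = 18 ∧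
    m8IntDisplayLevel 20 = 24 ∧ m8SupNormLevel 20 = 22 := by decide

end Literature.Geometry.Lorentzian.KlainermanSzeftel2021.InitializationLedger
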